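import Literature.Probability.RandomPlanarGeometry.SLE
import Literature.Probability.RandomPlanarGeometry.ChordalCurveFamily
import HarnessLib

/-!
# The splitting form of locality of chordal SLE₆ (target independence), as a named fact

Topic `Probability/RandomPlanarGeometry`. Lawler–Schramm–Werner, *Values of Brownian
intersection exponents I: Half-plane exponents*, Acta Math. **187** (2001), §2, Cor. 2.3
("Splitting property"), there deduced from the locality theorem (Thm. 2.2) for SLE₆; in lecture
form W. Werner, *Lectures on two-dimensional critical percolation* (2007), Prop. 3.4, and
G. F. Lawler, *Conformally Invariant Processes in the Plane* (2005), §6.3 (Möbius images of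
chordal SLE₆ are chordal SLE₆ up to the disconnection time).

Printed statements.
* [LSW 2001, Cor. 2.3] "Let `D` denote a simply connected domain such that `∂D` is a Jordan
  curve. Let `a`, `b` and `b'` denote three distinct points on `∂D`, and let `I` denote the
  connected component of `∂D ∖ {b, b'}` that does not contain `a`. Let `(K_t, t ≥ 0)` (respectively
  `K_t'`) denote an SLE₆ in `D` from `a` to `b` (resp. from `a` to `b'`). Let `T` (resp. `T'`)
  denote the first time at which `cl K_t` (resp. `cl K_t'`) intersects `I`. Then `(K_t, t < T)` and
  `(K_t', t < T')` have the same law up to time-change."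
* [Werner 2007, Prop. 3.4] "Consider a chordal SLE(6) process `γ` from `a` to `b` in the domain
  `D`, and a chordal SLE(6) process `γ'` from `a` to `b'` in `D`. Define `T` (respectively `T'`)
  the first time at which `γ` (resp. `γ'`) disconnects `b` from `b'` in `D`. Then, the two paths
  `γ[0, T]` and `γ'[0, T']` (defined modulo time-reparametrization) have the same law."

Transposition to the tree. Chordal SLE₆ in a Dobrushin domain is the law `IsSLELaw 6 D μ` on
curve classes (`CurveClass ℂ`, curves modulo reparametrisation, `SLE.lean`); a three-marked
Jordan domain `(D; a, b, b') = (D; p₀, p₁, p₂)` is a `MarkedDomain 3`, the curve to `b = p₁` lives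
in `D.chord 0 1`, the curve to `b' = p₂` in `D.chord 0 2`, and the closed arc `I ∪ {b, b'} = [p₁, p₂]`
is `D.arc 1`. "The path up to its first hitting of `[p₁, p₂]`, modulo reparametrisation" is
`CurveClass.stopAt (D.arc 1)` (`ChordalCurveFamily.lean`; for the SLE₆ trace the hitting time of
the closed arc is the disconnection time of `b` from `b'`, Lawler (2005) Rem. 6.6, and the curve is
continuous at that time, so the printed open-time-interval statement and the stopped-curve
statement agree). Exactly as in `ChordalFamily.IsTargetIndependent`, the two laws are compared
on the events `stopAt (D.arc 1) ⁻¹' T`, `T` Borel (no `Measure.map`).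

Contents.
* `IsSLELaw.targetIndependence_six` — NAMED FACT: the splitting property for any two chordal
  SLE₆ laws `μ₁` of `D.chord 0 1` and `μ₂` of `D.chord 0 2`.
* `ChordalFamily.isTargetIndependent_of_isSLELaw_six` — hence every family of chordal SLE₆ laws
  (`∀ D, IsSLELaw 6 D (Q D)`) is target independent (`ChordalFamily.IsTargetIndependent`).

What is NOT here: the proof (the Itô computation `dW̃ = h_t'(W_t) dW + (κ/2 − 3) h_t''(W_t) dt` for
the Möbius conjugation `h_t = g̃_t ∘ M ∘ g_t⁻¹`, driftless at `κ = 6`, a random time change, and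
the transport to `D` by a chordal uniformizing map); the converse "target independence among the
SLE_κ forces `κ = 6`" is `SLETargetIndependenceSix.lean`.
-/

noncomputable section

open MeasureTheory

namespace Literature.Probability.RandomPlanarGeometry

/-- NAMED FACT — **the splitting property (target independence) of chordal SLE₆**
(Lawler–Schramm–Werner (2001), Cor. 2.3: "Let `a`, `b` and `b'` denote three distinct points on
`∂D`, and let `I` denote the connected component of `∂D ∖ {b, b'}` that does not contain `a` …
Let `T` (resp. `T'`) denote the first time at which `cl K_t` (resp. `cl K_t'`) intersects `I`.
Then `(K_t, t < T)` and `(K_t', t < T')` have the same law up to time-change"; Werner (2007),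
Prop. 3.4: "the two paths `γ[0, T]` and `γ'[0, T']` (defined modulo time-reparametrization) have
the same law"), transposed to the tree's chordal SLE laws on curve classes: for a three-marked
Jordan domain `(D; p₀, p₁, p₂)` and chordal SLE₆ laws `μ₁` of `(D; p₀, p₁) = D.chord 0 1` and `μ₂`
of `(D; p₀, p₂) = D.chord 0 2`, the curves stopped at their first hitting of the closed boundary
arc `[p₁, p₂] = D.arc 1` have the same law: `μ₁ (stopAt (D.arc 1) ⁻¹' T) = μ₂ (stopAt (D.arc 1) ⁻¹' T)`
for every Borel `T`. [cite: Werner2007, Prop. 3.4] -/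
def IsSLELaw.targetIndependence_six : Prop :=
  ∀ (D : MarkedDomain 3) {μ₁ μ₂ : Measure (CurveClass ℂ)},
    IsSLELaw 6 (D.chord 0 1 (by decide)) μ₁ → IsSLELaw 6 (D.chord 0 2 (by decide)) μ₂ →
    ∀ T : Set (CurveClass ℂ), MeasurableSet T →
      μ₁ (CurveClass.stopAt (D.arc 1) ⁻¹' T) = μ₂ (CurveClass.stopAt (D.arc 1) ⁻¹' T)

/-- **A family of chordal SLE₆ laws is target independent** (`ChordalFamily.IsTargetIndependent`,
the splitting form of locality), given the named fact `IsSLELaw.targetIndependence_six`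
(hypothesis `h`; LSW (2001), Cor. 2.3 / Werner (2007), Prop. 3.4). [cite: Werner2007, Prop. 3.4] -/
theorem ChordalFamily.isTargetIndependent_of_isSLELaw_six (h : IsSLELaw.targetIndependence_six)
    {Q : ChordalFamily} (hQ : ∀ D : DobrushinDomain, IsSLELaw 6 D (Q D)) :
    Q.IsTargetIndependent :=
  fun D T hT => h D (hQ _) (hQ _) T hT

end Literature.Probability.RandomPlanarGeometry

end
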